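import Summits.BirchSwinnertonDyer.Rank1Residual.Additive.LocalTowerKernelAtPTwistedOrdinary
import Summits.BirchSwinnertonDyer.Rank1Residual.Additive.GoodModelQuotientMovedInKer
import Summits.BirchSwinnertonDyer.Rank1Residual.Additive.GoodModelKernelRationalPoints
import Summits.BirchSwinnertonDyer.Rank1Residual.Additive.GordRamifiedOrdinaryLineHigher
import HarnessLib

/-!
# T-T3B, class form: `W.localTowerKerPrimary κ ℚ_v 0 = ⊥` on the additive potentially good ORDINARY
# rows with `e ∈ {3, 4, 6}` (`p ≥ 5`, `p ≡ 1 (mod e)`) — p06's T-T3CTL binder `hp0` BY NAME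
# (team n1011, row T-T3B; seat p12 GEN 8; file F6)

HONEST FRAMING (cell `b2b-bsdres`, run/shared/lean/b2b/bsd-rank1-residual/, verbatim in every
file): the goal of the cell is to DELETE the COMBINATION-SHAPED residual classes of the
Birch–Swinnerton-Dyer formula for ALL analytic-rank `≤ 1` elliptic curves over `ℚ` — "full BSD
formula for every rank `≤ 1` curve in class `C`" assembled STRICTLY from published theorems — so
that the rank-`≤ 1` remainder becomes exactly the CONSTRUCTION-SHAPED classes, which are TYPED
(missing-input `Prop`s), NOT attempted. This is not "finishing BSD". Team n1011 (N10/N11; row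
T-T3B, skeleton `cells/n1011/skel/T-T3B.md`): research routes on CONSTRUCTION-SHAPED classes
(ROUTE 2: V20X / (G-ord) receivers and their congruent partners); prove what is provable now; no
claim beyond stated classes; census output = EVIDENCE, never a Literature fact; RESIDUAL-MAP marks
UNCHANGED; nothing is booked by this file. TOOL THEOREMS ONLY: no definition, no named fact,
nothing cited enters as a hypothesis. Closes no pair by itself: it supplies the `v ∣ p` socket
`hp0 κ v` of p06's `mu_anchor_of_card_selmer_eq_one_of_additive_away`
(`Iwasawa/LocalTowerKernelAdditive`) on the partner 9800bn1 @ 5 of the Route-2 row 499800el1, whose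
census input `hSel` and receiver-side inputs remain.

## What

* §1 `GoodModelLine.localTowerKerPrimary_zero_eq_bot_of_goodModel_of_hasAdditiveReductionAt` — the
  row's END (`Additive/LocalTowerKernelAtPTwistedOrdinary`, F5) with its four F4 binders DISCHARGED by
  p07's `Additive/GoodModelKernelRationalPoints` (`exists_red_eq_zero_and_nsmul_eq`,
  `exists_nsmul_red_eq_zero`, `finite_fixed_primary_red_ker`, `exists_fixed_red_ker_not_pdivisible`)
  and `hmove` by F6a `exists_mem_localSubgroup_ker_smul_sub_red_ne_zero`: hypotheses = the good
  model with an ordinary point (p05 F-A2 currency), `p` odd, `W` ADDITIVE at `v ∋ p`, ANY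
  `ℤ_p`-extension `κ`.
* §2 `GoodModelLine.localTowerKerPrimary_zero_eq_bot_of_typeGOrd_of_semistabilityIndex_ne_two` —
  the class form on the (G-ord) rows with `e_E(p) ∈ {3, 4, 6}`, `p ≥ 5` (`TypeGOrd W p`, `Addv W p`,
  `semistabilityIndex W p ≠ 2`): the good model and its ordinary point are built exactly as in
  p05's T-ROL-G F-C2 `exists_isRamifiedOrdinaryLine_of_typeGOrd_of_semistabilityIndex_ne_two`
  (Deuring's form `exists_goodModel_of_padicValRat_j_nonneg`; `j̃ ∈ {0, 1728}` and Deuring's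
  supersingularity criterion, F-B `GordHigherOrdinaryPoint`); and `ClassX4Gord.` / `ClassX3Gord.`
  corollaries `localTowerKerPrimary_zero_eq_bot_of_five_le_of_semistabilityIndex_ne_two`.

NOT covered here (honest scope): the `e = 2` rows (X4♯(G-ord) of Kodaira type `I₀*`, X3♯(G-ord)),
whose good model is the minimal model of the `p*`-twist and whose ordinary point comes from the
twist's `a_p` — the same END applies once that good model is written in F-A2's currency (successor
item); `p = 3`; the potentially multiplicative rows (Tate curve).

References: [GreenbergLNM1716] R. Greenberg, LNM 1716 (1999), §3 Lemma 3.4 (p. 89), Prop. 3.8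
(p. 95); [SilvermanAEC2009] J. H. Silverman, *AEC*, VII.5.5, V.4.1(a); cells/n1011/skel/T-T3B.md;
p06 `Iwasawa/LocalTowerKernelAdditive` (`hp0`); r2 ROUTE-2 §II.30.4.
-/

noncomputable section

open scoped Classical NNReal NumberField

open WeierstrassCurve

universe u

namespace Summit.BirchSwinnertonDyer.Rank1Residual.Additive.GoodModelLine

open NumberField IsDedekindDomain Field IsDedekindDomain.HeightOneSpectrum
  Literature.NumberTheory.GaloisRepresentations
  Literature.NumberTheory.EllipticCurves
  Literature.NumberTheory.EllipticCurves.GreenbergSelmer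
  Literature.NumberTheory.EllipticCurves.EmertonPollackWeston2006
  Literature.NumberTheory.EllipticCurves.Rank1Residual
  Literature.NumberTheory.EllipticCurves.Rank1Residual.Typed
  Summit.BirchSwinnertonDyer.Rank1Residual.X2.GreenbergVatsalReductionDatum
  Summit.BirchSwinnertonDyer.Rank1Residual.X2.GreenbergVatsalTateDatumCofree

/-! ## §1 The END with the F4 inputs and `hmove` discharged -/

section Local

variable (W : WeierstrassCurve ℚ) [W.IsElliptic] (p : ℕ) [hp : Fact p.Prime]
  {v : HeightOneSpectrum (𝓞 ℚ)}
  {C : VariableChange (AlgebraicClosure (v.adicCompletion ℚ))}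
  {W₀ : WeierstrassCurve (specVal v).integer}
  (hW₀ : C • (W.baseChange (v.adicCompletion ℚ)).baseChange (AlgebraicClosure (v.adicCompletion ℚ)) =
    W₀.baseChange (AlgebraicClosure (v.adicCompletion ℚ)))
  (hΔ : IsUnit W₀.Δ)
  (red : localPoints W (v.adicCompletion ℚ) →+
    (W₀.map (IsLocalRing.residue (specVal v).integer)).toAffine.Point)
  (hred : ∀ P, red P = goodReductionHom W₀ (Valuation.integer.integers (specVal v)) hΔ
    (Affine.Point.congrEquiv hW₀ (VariableChange.pointEquiv _ C
      (Affine.Point.congrEquiv (baseChange_baseChange_adicCompletion W v).symm P))))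

include hred in
/-- **T-T3B END, hypotheses discharged: a good model with an ordinary point at an ADDITIVE
`v ∋ p`, `p` odd ⟹ `W.localTowerKerPrimary κ (v.adicCompletion ℚ) 0 = ⊥` for every
`ℤ_p`-extension `κ` of `ℚ`.** F5 `localTowerKerPrimary_zero_eq_bot_of_goodModel` fed with p07's F4
(`exists_red_eq_zero_and_nsmul_eq`, `exists_nsmul_red_eq_zero`, `finite_fixed_primary_red_ker`,
`exists_fixed_red_ker_not_pdivisible`) and F6a `exists_mem_localSubgroup_ker_smul_sub_red_ne_zero`
(additive ⟹ bad). Greenberg LNM 1716 Lemma 3.4 at level `0` with both anomalous factors `= 1`.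
[cite: GreenbergLNM1716, §3 Lemma 3.4 (p. 89) and Prop. 3.8 (p. 95)] -/
theorem localTowerKerPrimary_zero_eq_bot_of_goodModel_of_hasAdditiveReductionAt
    (hpv : ((p : ℕ) : 𝓞 ℚ) ∈ v.asIdeal) (hp2 : p ≠ 2)
    (hord : ∃ P : (W₀.baseChange (AlgebraicClosure (v.adicCompletion ℚ))).toAffine.Point,
      (p : ℤ) • P = 0 ∧ goodReductionHom W₀ (Valuation.integer.integers (specVal v)) hΔ P ≠ 0)
    (hadd : W.HasAdditiveReductionAt v) (κ : ZpExtension ℚ p) :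
    W.localTowerKerPrimary κ (v.adicCompletion ℚ) 0 = ⊥ :=
  localTowerKerPrimary_zero_eq_bot_of_goodModel W p hW₀ hΔ red hred hpv hord κ
    (exists_red_eq_zero_and_nsmul_eq W p hW₀ hΔ red hred hpv hord)
    (fun P ↦ exists_nsmul_red_eq_zero W red P)
    (finite_fixed_primary_red_ker W p red hpv hadd)
    (exists_fixed_red_ker_not_pdivisible W p red hpv hadd)
    (exists_mem_localSubgroup_ker_smul_sub_red_ne_zero W p hW₀ hΔ red hred hpv hp2 hord
      hadd.not_hasGoodReductionAt κ)

end Local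

/-! ## §2 The class form on the `e ∈ {3, 4, 6}` rows -/

section Classes

variable (W : WeierstrassCurve ℚ) [W.IsGloballyMinimal] [W.IsElliptic] (p : ℕ) [hp : Fact p.Prime]
  {v : HeightOneSpectrum (𝓞 ℚ)}

set_option maxHeartbeats 400000 in
/-- **`W.localTowerKerPrimary κ ℚ_v 0 = ⊥` on the (G-ord) rows with `e_E(p) ∈ {3, 4, 6}`** (`p ≥ 5`;
globally minimal `W`, `TypeGOrd W p`, `Addv W p`, `semistabilityIndex W p ≠ 2`; ANY `ℤ_p`-extension
`κ`). The good model (Deuring's form, `exists_goodModel_of_padicValRat_j_nonneg`) and its ordinary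
point (`j̃ = 0`, `3 ∣ p − 1` / `j̃ = 1728`, `4 ∣ p − 1`: F-B
`exists_torsion_goodReductionHom_ne_zero_of_residue_c₄_eq_zero` / `_c₆_`) are produced VERBATIM as
in p05's F-C2 `exists_isRamifiedOrdinaryLine_of_typeGOrd_of_semistabilityIndex_ne_two`; then §1.
This is p06's `hp0 κ v` on 9800bn1 @ 5 ((5;4)).
[cite: GreenbergLNM1716, §3 Lemma 3.4 (p. 89) and Prop. 3.8 (p. 95)]
[cite: SilvermanAEC2009, Prop. VII.5.5 and Thm. V.4.1(a)] -/
theorem localTowerKerPrimary_zero_eq_bot_of_typeGOrd_of_semistabilityIndex_ne_two (hp5 : 5 ≤ p)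
    (hG : TypeGOrd W p) (hadd : Addv W p) (he : semistabilityIndex W p ≠ 2)
    (hpv : ((p : ℕ) : 𝓞 ℚ) ∈ v.asIdeal) (κ : ZpExtension ℚ p) :
    W.localTowerKerPrimary κ (v.adicCompletion ℚ) 0 = ⊥ := by
  have hp3 : p ≠ 3 := by omega
  have hp2 : p ≠ 2 := by omega
  -- data from (G)
  have hj : 0 ≤ padicValRat p W.j := padicValRat_j_nonneg_of_typeGOrd W p hG
  have hedvd : semistabilityIndex W p ∣ p - 1 :=
    ((typeG_iff_not_subM_and_semistabilityIndex_dvd W p hp5).mp hG.typeG).2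
  have he12 := semistabilityIndex_dvd_twelve W p
  have he1 := semistabilityIndex_ne_one_of_addv W p hp5 hadd hj
  have hecase : semistabilityIndex W p = 3 ∨ semistabilityIndex W p = 4 ∨ semistabilityIndex W p = 6 ∨
      semistabilityIndex W p = 12 := by
    have hle : semistabilityIndex W p ≤ 12 := Nat.le_of_dvd (by norm_num) he12
    interval_cases h : semistabilityIndex W p <;> omega
  -- the good model and the additive place
  obtain ⟨C, W₀, hW₀, hΔ⟩ := exists_goodModel_of_padicValRat_j_nonneg W p hpv hp3 hj
  have haddv : W.HasAdditiveReductionAt v := by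
    rw [eq_primesEquiv_symm p hpv]
    exact hasAdditiveReductionAt_of_addv W p hadd
  haveI := charP_residueField_specVal p hpv
  -- the ordinary point
  have hord : ∃ P : (W₀.baseChange (AlgebraicClosure (v.adicCompletion ℚ))).toAffine.Point,
      (p : ℤ) • P = 0 ∧ goodReductionHom W₀ (Valuation.integer.integers (specVal v)) hΔ P ≠ 0 := by
    by_cases h3e : 3 ∣ semistabilityIndex W p
    · have h3v : ¬ 3 ∣ padicValInt p W.minimalDiscriminantInt := by
        intro h
        have : 3 ∣ 4 := dvd_trans h3e (semistabilityIndex_dvd_four_of_three_dvd W p h)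
        omega
      exact exists_torsion_goodReductionHom_ne_zero_of_residue_c₄_eq_zero
        (O := (specVal v).valuationSubring) (Valuation.integer.integers (specVal v)) hΔ p hp5
        (dvd_trans h3e hedvd)
        (residue_c₄_eq_zero_of_goodModel W p hpv hW₀ hΔ
          (j_eq_zero_or_padicValRat_j_pos_of_not_three_dvd W p hj h3v))
    · have h4e : 4 ∣ semistabilityIndex W p := by
        rcases hecase with h | h | h | h <;> rw [h] at h3e ⊢ <;> omega
      have h2v : ¬ 2 ∣ padicValInt p W.minimalDiscriminantInt := by
        intro h
        have : 4 ∣ 6 := dvd_trans h4e (semistabilityIndex_dvd_six_of_two_dvd W p h)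
        omega
      exact exists_torsion_goodReductionHom_ne_zero_of_residue_c₆_eq_zero
        (O := (specVal v).valuationSubring) (Valuation.integer.integers (specVal v)) hΔ p hp5
        (dvd_trans h4e hedvd)
        (residue_c₆_eq_zero_of_goodModel W p hpv hW₀ hΔ
          (j_eq_or_padicValRat_j_sub_pos_of_not_two_dvd W p hp5 hj h2v))
  -- the reduction map of the good model
  let Φ₁ : localPoints W (v.adicCompletion ℚ) ≃+
      ((W.baseChange (v.adicCompletion ℚ)).baseChange (AlgebraicClosure (v.adicCompletion ℚ))).toAffine.Point :=
    Affine.Point.congrEquiv (baseChange_baseChange_adicCompletion W v).symm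
  let Φ : localPoints W (v.adicCompletion ℚ) ≃+
      (W₀.baseChange (AlgebraicClosure (v.adicCompletion ℚ))).toAffine.Point :=
    (Φ₁.trans (VariableChange.pointEquiv _ C)).trans (Affine.Point.congrEquiv hW₀)
  let red : localPoints W (v.adicCompletion ℚ) →+
      (W₀.map (IsLocalRing.residue (specVal v).integer)).toAffine.Point :=
    (goodReductionHom W₀ (Valuation.integer.integers (specVal v)) hΔ).comp Φ.toAddMonoidHom
  have hred : ∀ P, red P = goodReductionHom W₀ (Valuation.integer.integers (specVal v)) hΔ
      (Affine.Point.congrEquiv hW₀ (VariableChange.pointEquiv _ C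
        (Affine.Point.congrEquiv (baseChange_baseChange_adicCompletion W v).symm P))) := fun _ ↦ rfl
  exact localTowerKerPrimary_zero_eq_bot_of_goodModel_of_hasAdditiveReductionAt W p hW₀ hΔ red hred
    hpv hp2 hord haddv κ

variable {W p}

/-- **X4♯(G-ord), `e ∈ {3, 4, 6}`, `p ≥ 5`: the `v = p` local tower kernel at level `0` vanishes**
for every `ℤ_p`-extension (the `hp0 κ v` socket of p06's `mu_anchor_of_card_selmer_eq_one_of_additive_away`
on the (5;4) partners of Route 2). X4♯(G-ord) stays CONSTRUCTION-SHAPED; nothing booked.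
[cite: GreenbergLNM1716, §3 Lemma 3.4 (p. 89) and Prop. 3.8 (p. 95)] -/
theorem ClassX4Gord.localTowerKerPrimary_zero_eq_bot_of_five_le_of_semistabilityIndex_ne_two
    (hX : ClassX4Gord W p) (hp5 : 5 ≤ p) (he : semistabilityIndex W p ≠ 2)
    (hpv : ((p : ℕ) : 𝓞 ℚ) ∈ v.asIdeal) (κ : ZpExtension ℚ p) :
    W.localTowerKerPrimary κ (v.adicCompletion ℚ) 0 = ⊥ :=
  localTowerKerPrimary_zero_eq_bot_of_typeGOrd_of_semistabilityIndex_ne_two W p hp5 hX.typeGOrd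
    hX.addv.2 he hpv κ

/-- **X3♯(G-ord), `e ∈ {3, 4, 6}`, `p ≥ 5`: the `v = p` local tower kernel at level `0` vanishes**
for every `ℤ_p`-extension. X3♯(G-ord) stays as labelled; nothing booked.
[cite: GreenbergLNM1716, §3 Lemma 3.4 (p. 89) and Prop. 3.8 (p. 95)] -/
theorem ClassX3Gord.localTowerKerPrimary_zero_eq_bot_of_five_le_of_semistabilityIndex_ne_two
    (hX : ClassX3Gord W p) (hp5 : 5 ≤ p) (he : semistabilityIndex W p ≠ 2)
    (hpv : ((p : ℕ) : 𝓞 ℚ) ∈ v.asIdeal) (κ : ZpExtension ℚ p) :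
    W.localTowerKerPrimary κ (v.adicCompletion ℚ) 0 = ⊥ :=
  localTowerKerPrimary_zero_eq_bot_of_typeGOrd_of_semistabilityIndex_ne_two W p hp5 hX.typeGOrd
    hX.addv he hpv κ

end Classes

end Summit.BirchSwinnertonDyer.Rank1Residual.Additive.GoodModelLine

end
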